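import Summits.BirchSwinnertonDyer.BirchSwinnertonDyer.Theorems.KimAtThreeDeepUpperExpStarTowerRange
import HarnessLib

/-!
# (S5b-tower) PER CURVE AND PER TOWER: the class-currency reading `exists_smul_ranges_of_facts` re-keyed on the
# body of (S5b-tower) AT `(W, ℚ_v ⊆ L)` only (route `EdixhovenFibreFiveSeven`, crux K★ stmt-BirchSwinnertonDyer-22226,
# line `kato-lever`; seat `bsd-line-edix-p1` g29, LEAD)

HONEST FRAMING. TOOL theorem only (no definition, no named fact, no `sorry`; the file-local instance keys on `ℚ_v` are
byte-identical to `KimAtThreeDeepUpperExpStarTowerRange`); nothing is closed or booked; BSD / K★ are NOT proved by this.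

WHY (memo `Cruxes/StarredOptimalManinUnitFiveSeven/Lines/kato-lever-K3-H5-endpoint.md` §3 «SEAM»). The cite-only fact
(S5b-tower) `PAdicHodge.exists_smul_range_expStarCoord_tower_iff_trace_log` — and behind it Kato's explicit reciprocity
law [REC-tower] `tatePairingPoint_eq_trace_expStar_log_tower`, the stub `stub_reciprocityLaw` of the K★ skeleton
`Cruxes/StarredOptimalManinUnitFiveSeven/Lines/kato_lever.lean` v6 — quantifies over EVERY elliptic curve over EVERY field
of characteristic `0` and EVERY tower of `p`-adic fields `F₀ ⊆ F`. K★ consumes it at ONE place only: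
`KimAtThreeDeepUpperExpStarTowerRange.exists_smul_ranges_of_facts`, applied to ONE curve `W/ℚ` at the tower
`F₀ = ℚ_v ⊆ F = L` (`v = (p)`, `L` a factor field `ℚ(ζ_m)_w`). The line `kato_lever` constructs Kato's formula exactly at
such towers (the (K₂)^ram road + `…ReciprocityTowerFromAbove.exists_const_tower_clauses_of_formula_above`), never the
∀-fields statement. This file starts the PER-CURVE re-key of the consumer chain (as `…SemiLocalIntegralityPinAt` did for the
de Rham fact hDR): the statement of `exists_smul_ranges_of_facts` VERBATIM, with the hypothesis `hT₂` replaced by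

  `hT₂W` := the BODY of (S5b-tower) at `K₀ = ℚ`, this `W`, `F₀ = ℚ_v = Place.Completion (inr v)`, this `L`
  (universally quantified only over the auxiliary valuations `w₀`, `ν`, the line data `d₀`, `d` and the Prop-1.2.3 binders).

* ★ `exists_smul_ranges_of_rangeAt` — conclusion byte-identical to `exists_smul_ranges_of_facts`; proof = that proof with the
  single application `hT₂ W … hcompat` replaced by `hT₂W … hcompat`.

Downstream twins (sibling files of this seat): `…SemiLocalIntegralityOfRangeAt` (P4-coh §2 and the per-curve Pin §2),
`…AssemblyAtBarOfRangeAt` (F″ at one class), `…CellsOfRecTowerAt` (K★ ⟸ {P1-bar, [REC-tower] BODY at the cells' towers}).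

References: [Kato1993LNM1553] Ch. II §1.2.4, Thm. 1.4.1 (3)–(4), Lemma 1.4.3–1.4.5; [BlochKato1990] §3 Prop. 3.8,
Ex. 3.11; [SerreLocalFields1979] Ch. II §5 (rigidity of `ℚ_p`); [SilvermanAEC2009] IV.6.4, VII.2.2.
-/

set_option autoImplicit false
-- the Theorems namespace of a single-conjunct summit repeats the summit name by design (D-0017)
set_option linter.dupNamespace false

noncomputable section

open scoped NumberField NNReal Classical
open Field ValuativeRel IsDedekindDomain NumberField
open Literature.NumberTheory.GaloisRepresentations
open Literature.NumberTheory.GaloisRepresentations.PeriodRingData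
open Literature.NumberTheory.PAdicHodge
open Literature.NumberTheory.EllipticCurves WeierstrassCurve
open Literature.NumberTheory.EllipticCurves.FormalGroupChart (padicLogPointFiniteExt
  isIntegral_valuationInteger_of_isIntegral_padicInt)
open Summit.BirchSwinnertonDyer.BirchSwinnertonDyer.Theorems.KimAtThreeDeepLowerExpStarOmega
open Summit.BirchSwinnertonDyer.BirchSwinnertonDyer.Theorems.KimAtThreeDeepLowerExpStarOmegaPlace
open Summit.BirchSwinnertonDyer.BirchSwinnertonDyer.Theorems.KimAtThreeDeepLowerExpStarOmegaRes
open Summit.BirchSwinnertonDyer.BirchSwinnertonDyer.Theorems.KimAtThreeDeepUpperExpStarTransport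
open Summit.BirchSwinnertonDyer.BirchSwinnertonDyer.Theorems.KimAtThreeDeepUpperExpStarFacts
open Summit.BirchSwinnertonDyer.BirchSwinnertonDyer.Theorems.KimAtThreeDeepUpperExpStarFactsCanonical
open Summit.BirchSwinnertonDyer.BirchSwinnertonDyer.Theorems.KimAtThreeDeepUpperExpStarTowerRange
open Summit.BirchSwinnertonDyer.Rank1Residual.GaloisImage
open Summit.BirchSwinnertonDyer.Rank1Residual.Additive (LocalLog.padicLog)
open Rat.HeightOneSpectrum

namespace Summit.BirchSwinnertonDyer.BirchSwinnertonDyer.Theorems.StarredOptimalManinUnitFiveSevenTowerRangeAt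

variable (W : WeierstrassCurve ℚ) [W.IsElliptic] (p : ℕ) [Fact p.Prime]
  (v : HeightOneSpectrum (𝓞 ℚ)) [hv : Fact (((p : ℕ) : 𝓞 ℚ) ∈ v.asIdeal)]

-- FILE-LOCAL instance keys, byte-identical to the accepted `KimAtThreeDeepUpperExpStarTowerRange.lean` l.76–80 /
-- `…SemiLocalIntegralityPinAt.lean` l.77–80 (no library instance is overridden outside this file): the tree's `ℚ`-algebra
-- structure on `ℚ_v` first, then the local-field structures on `ℚ_v = Place.Completion (inr v)` of the W2 cell's `exp*_ω` API.
attribute [local instance 100000] NumberField.Place.instAlgebraCompletion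
attribute [local instance] valuativeRelPlace topologicalSpacePlace
attribute [local instance] isNonarchimedeanLocalField_place charZero_place
attribute [local instance] padicAlgebraPlace fact_not_isUnit_place isAdicComplete_place

variable {L : Type} [Field L] [ValuativeRel L] [TopologicalSpace L] [IsNonarchimedeanLocalField L]
  [CharZero L] [Algebra ℚ L] [Algebra (Place.Completion (Sum.inr v : Place ℚ)) L]
  [Fact (¬ IsUnit (p : integerC L))] [IsAdicComplete (Ideal.span {(p : integerC L)}) (integerC L)]
  (hL : valuation L p < 1) [Algebra ℚ_[p] L]

/-- ★ **(S5b-tower) instantiated in CLASS currency, PER CURVE / PER TOWER.** The statement of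
`KimAtThreeDeepUpperExpStarTowerRange.exists_smul_ranges_of_facts` VERBATIM — for a local Néron line `d` at `v ∋ p`
(Prop-1.2.3 binders `hinj`/`hex`), a factor field `L ⊇ ℚ_v` with a line datum `dw` of the tower representation
(binders `hinjw`/`hexw`) compatible under restriction ((RES_w)), there is ONE `e ∈ ℚ_vˣ` with
`range(ι ∘ exp*_{e•d}) = {a : ∀ Q ∈ E(ℚ_p), ‖a · log_ω Q‖ ≤ 1}` AND `range(exp*_{e•dw}) = (log_ω E(L))^∨` — but GRANTED ONLY
`hT₂W`, the body of the cite fact (S5b-tower) AT `(W, ℚ_v ⊆ L)` (this curve, this tower), instead of the ∀-fields fact.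
Proof: that of `exists_smul_ranges_of_facts`, with `hT₂ W …` replaced by `hT₂W …`. CONDITIONAL on the displayed hypothesis;
nothing is closed. [cite: Kato1993LNM1553, Ch. II Thm. 1.4.1 (3)–(4), Lemma 1.4.3–1.4.5 and §1.2.4]
[cite: BlochKato1990, Prop. 3.8 (p. 354), Example 3.11 (p. 361)] -/
theorem exists_smul_ranges_of_rangeAt [W.IsGloballyMinimal]
    (hT₂W : ∀ (w₀ : Valuation (Place.Completion (Sum.inr v : Place ℚ)) ℝ≥0) [w₀.Compatible]
        [(W.baseChange (Place.Completion (Sum.inr v : Place ℚ))).IsIntegral w₀.integer]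
        (ν : Valuation L ℝ≥0) [ν.Compatible] [(W.baseChange L).IsIntegral ν.integer]
        (d₀ : LocalNeronLineAt W p v)
        (d : LocalNeronLine W hL ((galRestrictPlace v).comp
          (absGaloisRestrict (Place.Completion (Sum.inr v : Place ℚ)) L))),
        (bdRPeriodRingData (valuation_place_lt_one p v)).CupLogInjective (logCyclotomic p)
          (localRationalTateRep W p (galRestrictPlace v)) →
        (∀ z : contOneCocycles (localRationalTateRep W p (galRestrictPlace v)).toTopRep,
          (bdRPeriodRingData (valuation_place_lt_one p v)).HasDualExp (logCyclotomic p)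
            (localRationalTateRep W p (galRestrictPlace v)) fun σ => z.1 σ) →
        (bdRPeriodRingData (F := L) (p := p) hL).CupLogInjective (logCyclotomic p)
          (localRationalTateRep W p
            ((galRestrictPlace v).comp (absGaloisRestrict (Place.Completion (Sum.inr v : Place ℚ)) L))) →
        (∀ z : contOneCocycles (localRationalTateRep W p
            ((galRestrictPlace v).comp (absGaloisRestrict (Place.Completion (Sum.inr v : Place ℚ)) L))).toTopRep,
          (bdRPeriodRingData (F := L) (p := p) hL).HasDualExp (logCyclotomic p)
            (localRationalTateRep W p
              ((galRestrictPlace v).comp (absGaloisRestrict (Place.Completion (Sum.inr v : Place ℚ)) L)))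
            fun σ => z.1 σ) →
        (∀ (η₀ : contOneCocycles (restrictedTateRep W (Place.Completion (Sum.inr v : Place ℚ)) p).toTopRep)
            (η : contOneCocycles ((restrictedTateRep W (Place.Completion (Sum.inr v : Place ℚ)) p).restrict
              (absGaloisRestrict (Place.Completion (Sum.inr v : Place ℚ)) L)).toTopRep),
            (∀ σ, η.1 σ = η₀.1 (absGaloisRestrict (Place.Completion (Sum.inr v : Place ℚ)) L σ)) →
            expStarCoordTower W (F₀ := Place.Completion (Sum.inr v : Place ℚ)) hL d η =
              algebraMap (Place.Completion (Sum.inr v : Place ℚ)) L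
                (expStarCoord W (valuation_place_lt_one p v) d₀ η₀)) →
        ∃ (e : Place.Completion (Sum.inr v : Place ℚ)) (he : e ≠ 0),
          (∀ a₀ : Place.Completion (Sum.inr v : Place ℚ),
            (∃ η₀ : contOneCocycles (restrictedTateRep W (Place.Completion (Sum.inr v : Place ℚ)) p).toTopRep,
                expStarCoord W (valuation_place_lt_one p v) (d₀.smul e he) η₀ = a₀) ↔
              ∀ P : (W.baseChange (Place.Completion (Sum.inr v : Place ℚ))).toAffine.Point,
                ‖Algebra.trace ℚ_[p] (Place.Completion (Sum.inr v : Place ℚ))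
                    (a₀ * padicLogPointFiniteExt w₀
                      (W.baseChange (Place.Completion (Sum.inr v : Place ℚ))) p P)‖ ≤ 1) ∧
          (∀ a : L,
            (∃ η : contOneCocycles ((restrictedTateRep W (Place.Completion (Sum.inr v : Place ℚ)) p).restrict
                (absGaloisRestrict (Place.Completion (Sum.inr v : Place ℚ)) L)).toTopRep,
                expStarCoordTower W (F₀ := Place.Completion (Sum.inr v : Place ℚ)) hL
                  (d.smul (algebraMap (Place.Completion (Sum.inr v : Place ℚ)) L e)
                    ((map_ne_zero (algebraMap (Place.Completion (Sum.inr v : Place ℚ)) L)).mpr he)) η = a) ↔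
              ∀ P : (W.baseChange L).toAffine.Point,
                ‖Algebra.trace ℚ_[p] L (a * padicLogPointFiniteExt ν (W.baseChange L) p P)‖ ≤ 1))
    (d : LocalNeronLineAt W p v)
    (hinj : (bdRPeriodRingData (valuation_place_lt_one p v)).CupLogInjective (logCyclotomic p)
      (localRationalTateRep W p (galRestrictPlace v)))
    (hex : ∀ z : contOneCocycles (localRationalTateRep W p (galRestrictPlace v)).toTopRep,
      (bdRPeriodRingData (valuation_place_lt_one p v)).HasDualExp (logCyclotomic p)
        (localRationalTateRep W p (galRestrictPlace v)) fun σ => z.1 σ)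
    (ν : Valuation L ℝ≥0) [ν.Compatible] [(W.baseChange L).IsIntegral ν.integer]
    (dw : LocalNeronLine W hL ((galRestrictPlace v).comp
      (absGaloisRestrict (Place.Completion (Sum.inr v : Place ℚ)) L)))
    (hinjw : (bdRPeriodRingData (F := L) (p := p) hL).CupLogInjective (logCyclotomic p)
      (localRationalTateRep W p
        ((galRestrictPlace v).comp (absGaloisRestrict (Place.Completion (Sum.inr v : Place ℚ)) L))))
    (hexw : ∀ z : contOneCocycles (localRationalTateRep W p
        ((galRestrictPlace v).comp (absGaloisRestrict (Place.Completion (Sum.inr v : Place ℚ)) L))).toTopRep,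
      (bdRPeriodRingData (F := L) (p := p) hL).HasDualExp (logCyclotomic p)
        (localRationalTateRep W p
          ((galRestrictPlace v).comp (absGaloisRestrict (Place.Completion (Sum.inr v : Place ℚ)) L)))
        fun σ => z.1 σ)
    (hres : ∀ h : (tateLocalRep W p (Sum.inr v)).cohomology 1,
      expStarOmegaHom hL _ dw hinjw hexw
          ((tateLocalRep W p (Sum.inr v)).cohomologyRes
            (absGaloisRestrict (Place.Completion (Sum.inr v : Place ℚ)) L) 1 h) =
        algebraMap (Place.Completion (Sum.inr v : Place ℚ)) L (expStarOmegaAt d h))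
    (ι : Place.Completion (Sum.inr v : Place ℚ) →+* ℚ_[p]) :
    ∃ (e : Place.Completion (Sum.inr v : Place ℚ)) (he : e ≠ 0),
      (∀ a : ℚ_[p], (∃ y, expStarOmegaPadicAt (d.smul e he) hinj hex ι y = a) ↔
        ∀ Q : (W.baseChange ℚ_[p]).toAffine.Point, ‖a * LocalLog.padicLog (W.baseChange ℚ_[p]) Q‖ ≤ 1) ∧
      (∀ a : L,
        (∃ y, expStarOmegaHom hL _ (dw.smul (algebraMap (Place.Completion (Sum.inr v : Place ℚ)) L e)
            ((map_ne_zero (algebraMap (Place.Completion (Sum.inr v : Place ℚ)) L)).mpr he)) hinjw hexw y = a) ↔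
        ∀ P' : (W.baseChange L).toAffine.Point,
          ‖Algebra.trace ℚ_[p] L (a * padicLogPointFiniteExt ν (W.baseChange L) p P')‖ ≤ 1) := by
  have hpv : ((p : ℕ) : 𝓞 ℚ) ∈ v.asIdeal := hv.out
  have hp' := primesEquiv_eq p v hpv
  subst hp'
  -- the isomorphism `ℚ_v ≃ ℚ_p` and the transported `p`-adic norm (as in `hdual_of_facts`)
  let eA0 : v.adicCompletion ℚ ≃ₐ[ℚ] ℚ_[((primesEquiv v : Nat.Primes) : ℕ)] :=
    (adicCompletion.padicEquiv (R := 𝓞 ℚ) v).toAlgEquiv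
  let eA : Place.Completion (Sum.inr v : Place ℚ) ≃ₐ[ℚ] ℚ_[((primesEquiv v : Nat.Primes) : ℕ)] := eA0
  have hcont : Continuous eA0.symm := (adicCompletion.padicEquiv (R := 𝓞 ℚ) v).symm.continuous
  let w' : Valuation (v.adicCompletion ℚ) ℝ≥0 :=
    (NormedField.valuation (K := ℚ_[((primesEquiv v : Nat.Primes) : ℕ)])).comap
      (eA0 : v.adicCompletion ℚ →+* _)
  let w : Valuation (Place.Completion (Sum.inr v : Place ℚ)) ℝ≥0 := w'
  have hw : ∀ x, w' x = ‖eA0 x‖₊ := fun x => rfl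
  haveI : w.Compatible := compatible_of_norm_algEquiv _ v eA0 w' hw (norm_padicEquiv_le_one_iff v)
  haveI hIv : (W.baseChange (v.adicCompletion ℚ)).IsIntegral w'.integer :=
    isIntegral_baseChange_of_norm_algEquiv eA0 hw W
  haveI : (W.baseChange (Place.Completion (Sum.inr v : Place ℚ))).IsIntegral w.integer := hIv
  -- the compatibility of the two line data on crossed homomorphisms, from (RES_w) on classes
  have hcompat : ∀ (η₀ : contOneCocycles (restrictedTateRep W (Place.Completion (Sum.inr v : Place ℚ))
        ((primesEquiv v : Nat.Primes) : ℕ)).toTopRep)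
      (η : contOneCocycles ((restrictedTateRep W (Place.Completion (Sum.inr v : Place ℚ))
        ((primesEquiv v : Nat.Primes) : ℕ)).restrict
          (absGaloisRestrict (Place.Completion (Sum.inr v : Place ℚ)) L)).toTopRep),
      (∀ σ, η.1 σ = η₀.1 (absGaloisRestrict (Place.Completion (Sum.inr v : Place ℚ)) L σ)) →
      expStarCoordTower W (F₀ := Place.Completion (Sum.inr v : Place ℚ)) hL dw η =
        algebraMap (Place.Completion (Sum.inr v : Place ℚ)) L
          (expStarCoord W (valuation_place_lt_one _ v) d η₀) := by
    intro η₀ η hη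
    have hcl : oneCocycleClass (localTateRep W _ ((galRestrictPlace v).comp
          (absGaloisRestrict (Place.Completion (Sum.inr v : Place ℚ)) L))).toTopRep η =
        (tateLocalRep W _ (Sum.inr v)).cohomologyRes
          (absGaloisRestrict (Place.Completion (Sum.inr v : Place ℚ)) L) 1 (oneCocycleClass _ η₀) := by
      rw [cohomologyRes_oneCocycleClass]
      congr 1
      apply Subtype.ext
      apply ContinuousMap.ext
      intro σ
      exact hη σ
    rw [← expStarOmegaHom_comp_oneCocycleClass W _ v hL dw hinjw hexw, hcl, hres,
      expStarOmegaAt_eq_expStarCoord]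
  obtain ⟨e, he, h0, h1⟩ := hT₂W w ν d dw hinj hex hinjw hexw hcompat
  refine ⟨e, he, ?_, fun a => ?_⟩
  · -- (i): the base conjunct read in `ℚ_p` (rigidity: `ι = padicEquiv`)
    rw [ringHom_place_padic_ext _ v ι (eA : Place.Completion (Sum.inr v : Place ℚ) →+* _)]
    intro a
    have key := h0 (eA.symm a)
    have hLHS : (∃ y, expStarOmegaPadicAt (d.smul e he) hinj hex
          (eA : Place.Completion (Sum.inr v : Place ℚ) →+* _) y = a) ↔
        ∃ η : contOneCocycles (restrictedTateRep W (Place.Completion (Sum.inr v : Place ℚ)) _).toTopRep,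
          expStarCoord W (valuation_place_lt_one _ v) (d.smul e he) η = eA.symm a := by
      constructor
      · rintro ⟨y, hy⟩
        obtain ⟨η, rfl⟩ := oneCocycleClass_surjective _ y
        refine ⟨η, ?_⟩
        rw [expStarOmegaPadicAt_apply, expStarOmegaAt_eq_expStarCoord] at hy
        rw [← hy]
        exact (eA.symm_apply_apply _).symm
      · rintro ⟨η, hη⟩
        refine ⟨oneCocycleClass _ η, ?_⟩
        rw [expStarOmegaPadicAt_apply, expStarOmegaAt_eq_expStarCoord, hη]
        exact eA.apply_symm_apply a
    haveI := isIntegral_valuationInteger_of_isIntegral_padicInt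
      (W.baseChange ℚ_[((primesEquiv v : Nat.Primes) : ℕ)])
    have hlog : ∀ P : (W.baseChange (Place.Completion (Sum.inr v : Place ℚ))).toAffine.Point,
        eA (eA.symm a * padicLogPointFiniteExt w
            (W.baseChange (Place.Completion (Sum.inr v : Place ℚ))) ((primesEquiv v : Nat.Primes) : ℕ) P) =
          a * LocalLog.padicLog (W.baseChange ℚ_[((primesEquiv v : Nat.Primes) : ℕ)])
            (WeierstrassCurve.Affine.Point.map (eA : Place.Completion (Sum.inr v : Place ℚ) →ₐ[ℚ] _) P) := by
      intro P
      rw [map_mul, AlgEquiv.apply_symm_apply, padicLog_eq_padicLogPointFiniteExt]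
      congr 1
      exact (padicLogPointFiniteExt_map_algEquiv eA0 hw W P).symm
    have htr : ∀ x : Place.Completion (Sum.inr v : Place ℚ),
        Algebra.trace ℚ_[((primesEquiv v : Nat.Primes) : ℕ)] (Place.Completion (Sum.inr v : Place ℚ)) x = eA x :=
      fun x => trace_eq _ v eA0 hpv hcont x
    have hRHS : (∀ P : (W.baseChange (Place.Completion (Sum.inr v : Place ℚ))).toAffine.Point,
        ‖Algebra.trace ℚ_[((primesEquiv v : Nat.Primes) : ℕ)] (Place.Completion (Sum.inr v : Place ℚ))
            (eA.symm a * padicLogPointFiniteExt w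
              (W.baseChange (Place.Completion (Sum.inr v : Place ℚ))) ((primesEquiv v : Nat.Primes) : ℕ) P)‖ ≤ 1) ↔
        ∀ Q : (W.baseChange ℚ_[((primesEquiv v : Nat.Primes) : ℕ)]).toAffine.Point,
          ‖a * LocalLog.padicLog (W.baseChange ℚ_[((primesEquiv v : Nat.Primes) : ℕ)]) Q‖ ≤ 1 := by
      constructor
      · intro h Q
        obtain ⟨P, rfl⟩ := exists_map_algEquiv_eq eA0 W Q
        have hP := h P
        rwa [htr, hlog] at hP
      · intro h P
        rw [htr, hlog]
        exact h _
    exact hLHS.trans (key.trans hRHS)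
  · -- (ii): classes vs crossed homomorphisms on the tower representation
    refine Iff.trans ?_ (h1 a)
    constructor
    · rintro ⟨y, hy⟩
      obtain ⟨η, rfl⟩ := oneCocycleClass_surjective _ y
      exact ⟨η, by rw [← expStarOmegaHom_comp_oneCocycleClass W _ v hL _ hinjw hexw]; exact hy⟩
    · rintro ⟨η, hη⟩
      exact ⟨oneCocycleClass _ η, by rw [expStarOmegaHom_comp_oneCocycleClass W _ v hL _ hinjw hexw]; exact hη⟩

end Summit.BirchSwinnertonDyer.BirchSwinnertonDyer.Theorems.StarredOptimalManinUnitFiveSevenTowerRangeAt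

end
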